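import Summits.ValiantsHypothesis.ValiantsHypothesis.Theorems.BarrierLeverPartitionMinorsHitByVPSamePattern
import Summits.ValiantsHypothesis.ValiantsHypothesis.Theorems.BarrierLeverPartitionMinorsHitByVPOfLowerSets
import Summits.ValiantsHypothesis.ValiantsHypothesis.Theorems.BarrierLeverPartitionMinorsHitByVPOrProjections

/-!
# Route BarrierLever — item `PartitionMinorsHitByVP` (stmt-ValiantsHypothesis-19717):
# EVERY «SAME PATTERN» LAYOUT IS HIT — rows and columns through the same set family; all principal minors

Helper file (`--supports stmt-ValiantsHypothesis-19717`; cell valiant-natproofs, rung V4, 𝒟-side door (c); prover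
seat val-np-p6 gen 6). Definition-free. Closes NO item.

`…HitByVPSamePattern` hits every layout whose rows and columns run through the same LOWER SET (simplicial complex).
Here the lower-set condition is removed with val-np-p1 g12's down-compression (`DownCompression.step_x`, `step_y`):
compressing the rows AND the columns at the same coordinate sends two families with equal ranges to two families
with equal ranges (`range_compress_eq`: the compressed member depends only on the member and on the RANGE), so after
`h` coordinates both ranges are the same lower set and `partitionMinor_hit_samePattern_lowerSet` applies; each
coordinate costs two linear factors (`+6` size, `+2` degree), and the truncation to degree `2h` lands in exponent `9`.

* **`partitionMinor_hit_samePattern`** — for `h ≥ 4`, every `r`, and EVERY pair of injective families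
  `u, w : Fin r → Finset (Fin h)` with `Set.range u = Set.range w` (the columns run through the same `r` sets as the
  rows, in any order), some `f ∈ SmallCircuits ℂ (h+h) 9` has a nonsingular partition minor `[coeff_{x^{u i} y^{w j}} f]`.
* **`partitionMinor_hit_principal`** — in particular every PRINCIPAL minor (`w = u`) of every size `r ≤ 2^h`.

WHAT THIS IS NOT: the general item has independent row and column families (T1 / F_3 / Q* territory, OPEN); the
witness depends on the layout (no single `f` for all principal minors); nothing on crux 14610 or VP vs VNP.
-/

set_option linter.dupNamespace false

namespace Summit.ValiantsHypothesis.ValiantsHypothesis.Theorems.BarrierLever.FrobeniusDoor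

open Finset MvPolynomial Matrix
open Literature.Barriers.ValiantsHypothesis Literature.Computability.AlgebraicComplexity
open Summit.ValiantsHypothesis.ValiantsHypothesis.Theorems.BarrierLever.AdditiveDoor
  (truncation_spec degree_partitionExpo_le partitionMinor_hit_of_additive)
open Summit.ValiantsHypothesis.ValiantsHypothesis.Theorems.BarrierLever.DownCompression
  (step_x step_y injective_of_compOf isComp_of_compOf isComp_of_compOf_of_isComp isLowerSet_range_of_isComp
    bounds_mul_one_add_C_mul_X size_le_pow)

noncomputable section

variable {h r : ℕ}

/-- The compression at one coordinate, written as a function of the member and of the RANGE. -/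
theorem compress_eq_of_range (u : Fin r → Finset (Fin h)) (a : Fin h) (v : Fin r → Finset (Fin h))
    (hv₁ : ∀ i, a ∈ u i → (∀ k, u k ≠ (u i).erase a) → v i = (u i).erase a)
    (hv₂ : ∀ i, ¬ (a ∈ u i ∧ ∀ k, u k ≠ (u i).erase a) → v i = u i) (i : Fin r) :
    v i = if a ∈ u i ∧ (u i).erase a ∉ Set.range u then (u i).erase a else u i := by
  by_cases hc : a ∈ u i ∧ ∀ k, u k ≠ (u i).erase a
  · rw [hv₁ i hc.1 hc.2, if_pos ⟨hc.1, fun ⟨k, hk⟩ => hc.2 k hk⟩]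
  · rw [hv₂ i hc, if_neg]
    rintro ⟨ha, hnot⟩
    exact hc ⟨ha, fun k hk => hnot ⟨k, hk⟩⟩

/-- **Equal ranges stay equal under simultaneous compression.** -/
theorem range_compress_eq (u w : Fin r → Finset (Fin h)) (huw : Set.range u = Set.range w) (a : Fin h)
    (u' w' : Fin r → Finset (Fin h))
    (hu₁ : ∀ i, a ∈ u i → (∀ k, u k ≠ (u i).erase a) → u' i = (u i).erase a)
    (hu₂ : ∀ i, ¬ (a ∈ u i ∧ ∀ k, u k ≠ (u i).erase a) → u' i = u i)
    (hw₁ : ∀ j, a ∈ w j → (∀ k, w k ≠ (w j).erase a) → w' j = (w j).erase a)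
    (hw₂ : ∀ j, ¬ (a ∈ w j ∧ ∀ k, w k ≠ (w j).erase a) → w' j = w j) :
    Set.range u' = Set.range w' := by
  classical
  let φ : Finset (Fin h) → Finset (Fin h) := fun U => if a ∈ U ∧ U.erase a ∉ Set.range u then U.erase a else U
  have hu' : ∀ i, u' i = φ (u i) := fun i => compress_eq_of_range u a u' hu₁ hu₂ i
  have hw' : ∀ j, w' j = φ (w j) := fun j => by
    rw [compress_eq_of_range w a w' hw₁ hw₂ j]
    simp only [φ, huw]
  have h1 : Set.range u' = φ '' Set.range u := by
    ext S; constructor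
    · rintro ⟨i, rfl⟩; exact ⟨u i, ⟨i, rfl⟩, (hu' i).symm⟩
    · rintro ⟨U, ⟨i, rfl⟩, rfl⟩; exact ⟨i, hu' i⟩
  have h2 : Set.range w' = φ '' Set.range w := by
    ext S; constructor
    · rintro ⟨j, rfl⟩; exact ⟨w j, ⟨j, rfl⟩, (hw' j).symm⟩
    · rintro ⟨U, ⟨j, rfl⟩, rfl⟩; exact ⟨j, hw' j⟩
  rw [h1, h2, huw]

/-- **Simultaneous compression.** If every injective pair `(v, v')` with equal lower-set ranges is hit at size `≤ s`,
degree `≤ d`, then every injective pair `(u, w)` with `Set.range u = Set.range w` that is already compressed at the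
coordinates `a` with `a + m < h` is hit at size `≤ s + 6m`, degree `≤ d + 2m`. -/
theorem iterate_same (s d : ℕ)
    (hyp : ∀ v v' : Fin r → Finset (Fin h), Function.Injective v → Function.Injective v' →
      Set.range v = Set.range v' → IsLowerSet (Set.range v) →
      ∃ f : MvPolynomial (Fin (h + h)) ℂ, complexity f ≤ s ∧ f.totalDegree ≤ d ∧
        (Matrix.of fun i j : Fin r => MvPolynomial.coeff
          (∑ a ∈ v i, Finsupp.single (Fin.castAdd h a) 1 +
            ∑ c ∈ v' j, Finsupp.single (Fin.natAdd h c) 1) f).det ≠ 0) :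
    ∀ m : ℕ, m ≤ h → ∀ u w : Fin r → Finset (Fin h), Function.Injective u → Function.Injective w →
      Set.range u = Set.range w →
      (∀ a : Fin h, a.val + m < h → ∀ i, a ∈ u i → ∃ k, u k = (u i).erase a) →
      (∀ a : Fin h, a.val + m < h → ∀ j, a ∈ w j → ∃ k, w k = (w j).erase a) →
      ∃ f : MvPolynomial (Fin (h + h)) ℂ, complexity f ≤ s + 6 * m ∧ f.totalDegree ≤ d + 2 * m ∧
        (Matrix.of fun i j : Fin r => MvPolynomial.coeff
          (∑ a ∈ u i, Finsupp.single (Fin.castAdd h a) 1 +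
            ∑ c ∈ w j, Finsupp.single (Fin.natAdd h c) 1) f).det ≠ 0 := by
  classical
  intro m
  induction m with
  | zero =>
    intro _ u w hu hw huw hcu _
    have hlow : IsLowerSet (Set.range u) :=
      isLowerSet_range_of_isComp u (fun a i hai => hcu a (by have := a.isLt; omega) i hai)
    obtain ⟨f, hfs, hfd, hf⟩ := hyp u w hu hw huw hlow
    exact ⟨f, by omega, by omega, hf⟩
  | succ m ih =>
    intro hm u w hu hw huw hcu hcw
    set a₀ : Fin h := ⟨h - (m + 1), by omega⟩ with ha₀_def
    -- compress rows and columns at `a₀`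
    let u' : Fin r → Finset (Fin h) := fun i =>
      if a₀ ∈ u i ∧ ∀ k, u k ≠ (u i).erase a₀ then (u i).erase a₀ else u i
    let w' : Fin r → Finset (Fin h) := fun j =>
      if a₀ ∈ w j ∧ ∀ k, w k ≠ (w j).erase a₀ then (w j).erase a₀ else w j
    have hu₁ : ∀ i, a₀ ∈ u i → (∀ k, u k ≠ (u i).erase a₀) → u' i = (u i).erase a₀ :=
      fun i h1 h2 => by simp only [u', if_pos (And.intro h1 h2)]
    have hu₂ : ∀ i, ¬ (a₀ ∈ u i ∧ ∀ k, u k ≠ (u i).erase a₀) → u' i = u i :=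
      fun i h1 => by simp only [u', if_neg h1]
    have hw₁ : ∀ j, a₀ ∈ w j → (∀ k, w k ≠ (w j).erase a₀) → w' j = (w j).erase a₀ :=
      fun j h1 h2 => by simp only [w', if_pos (And.intro h1 h2)]
    have hw₂ : ∀ j, ¬ (a₀ ∈ w j ∧ ∀ k, w k ≠ (w j).erase a₀) → w' j = w j :=
      fun j h1 => by simp only [w', if_neg h1]
    have hu'_inj : Function.Injective u' := injective_of_compOf u u' a₀ hu hu₁ hu₂
    have hw'_inj : Function.Injective w' := injective_of_compOf w w' a₀ hw hw₁ hw₂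
    have huw' : Set.range u' = Set.range w' := range_compress_eq u w huw a₀ u' w' hu₁ hu₂ hw₁ hw₂
    have hcomp : ∀ (v v' : Fin r → Finset (Fin h)),
        (∀ i, a₀ ∈ v i → (∀ k, v k ≠ (v i).erase a₀) → v' i = (v i).erase a₀) →
        (∀ i, ¬ (a₀ ∈ v i ∧ ∀ k, v k ≠ (v i).erase a₀) → v' i = v i) →
        (∀ a : Fin h, a.val + (m + 1) < h → ∀ i, a ∈ v i → ∃ k, v k = (v i).erase a) →
        ∀ a : Fin h, a.val + m < h → ∀ i, a ∈ v' i → ∃ k, v' k = (v' i).erase a := by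
      intro v v' hv₁ hv₂ hcv a ha
      by_cases haa : a = a₀
      · subst haa
        exact isComp_of_compOf v v' _ hv₁ hv₂
      · have ha' : a.val + (m + 1) < h := by
          have : a.val ≠ h - (m + 1) := fun hv => haa (Fin.ext (by rw [hv, ha₀_def]))
          omega
        exact isComp_of_compOf_of_isComp v v' a a₀ (hcv a ha') hv₁ hv₂
    obtain ⟨f, hfs, hfd, hf⟩ := ih (by omega) u' w' hu'_inj hw'_inj huw' (hcomp u u' hu₁ hu₂ hcu)
      (hcomp w w' hw₁ hw₂ hcw)
    -- undo the column compression (rows `u'` fixed), then the row compression (columns `w` fixed)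
    obtain ⟨t, ht⟩ := step_y u' w w' a₀ hw₁ hw₂ f hf
    obtain ⟨hs₁, hd₁⟩ := bounds_mul_one_add_C_mul_X f t (Fin.natAdd h a₀) _ _ hfs hfd
    obtain ⟨t', ht'⟩ := step_x u u' w a₀ hu₁ hu₂ _ ht
    obtain ⟨hs₂, hd₂⟩ := bounds_mul_one_add_C_mul_X _ t' (Fin.castAdd h a₀) _ _ hs₁ hd₁
    exact ⟨_, by omega, by omega, ht'⟩

/-- **EVERY «SAME PATTERN» LAYOUT IS HIT.** For `h ≥ 4`, every `r` and every pair of injective families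
`u, w : Fin r → Finset (Fin h)` with `Set.range u = Set.range w`, some `f ∈ SmallCircuits ℂ (h+h) 9` has a nonsingular
partition minor `[coeff_{x^{u i} y^{w j}} f]_{i,j}`. -/
theorem partitionMinor_hit_samePattern (hh : 4 ≤ h) (u w : Fin r → Finset (Fin h))
    (hu : Function.Injective u) (hw : Function.Injective w) (huw : Set.range u = Set.range w) :
    ∃ f ∈ SmallCircuits ℂ (h + h) 9,
      (Matrix.of fun i j : Fin r => MvPolynomial.coeff
        (∑ a ∈ u i, Finsupp.single (Fin.castAdd h a) 1 +
          ∑ c ∈ w j, Finsupp.single (Fin.natAdd h c) 1) f).det ≠ 0 := by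
  have hh2 : 2 ≤ h := by omega
  have hyp : ∀ v v' : Fin r → Finset (Fin h), Function.Injective v → Function.Injective v' →
      Set.range v = Set.range v' → IsLowerSet (Set.range v) →
      ∃ f : MvPolynomial (Fin (h + h)) ℂ, complexity f ≤ (h + h) ^ 5 ∧ f.totalDegree ≤ h + h ∧
        (Matrix.of fun i j : Fin r => MvPolynomial.coeff
          (∑ a ∈ v i, Finsupp.single (Fin.castAdd h a) 1 +
            ∑ c ∈ v' j, Finsupp.single (Fin.natAdd h c) 1) f).det ≠ 0 := by
    intro v v' hv hv' hvv' hlow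
    obtain ⟨f, ⟨hfd, hfs⟩, hf⟩ := partitionMinor_hit_samePattern_lowerSet hh2 v v' hv hv' hvv' hlow
    exact ⟨f, hfs, hfd, hf⟩
  obtain ⟨g, hgs, hgd, hg⟩ := iterate_same ((h + h) ^ 5) (h + h) hyp h le_rfl u w hu hw huw
    (fun a ha => absurd ha (by omega)) (fun a ha => absurd ha (by omega))
  obtain ⟨hdeg, hcoeff, hsize⟩ := truncation_spec g (h + h)
  refine ⟨∑ k ∈ Finset.range (h + h + 1), homogeneousComponent k g, ⟨hdeg, ?_⟩, ?_⟩
  · calc complexity (∑ k ∈ Finset.range (h + h + 1), homogeneousComponent k g)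
        ≤ (h + h + 2) ^ 2 * complexity g + (h + h + 1) := hsize
      _ ≤ (h + h + 2) ^ 2 * ((h + h) ^ 5 + 6 * h) + (h + h + 1) := by gcongr
      _ ≤ (h + h) ^ (5 + 4) := size_le_pow h 5 hh
  · have hmat : (Matrix.of fun i j : Fin r => MvPolynomial.coeff
        (∑ a ∈ u i, Finsupp.single (Fin.castAdd h a) 1 +
          ∑ c ∈ w j, Finsupp.single (Fin.natAdd h c) 1)
        (∑ k ∈ Finset.range (h + h + 1), homogeneousComponent k g)) =
        Matrix.of fun i j : Fin r => MvPolynomial.coeff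
          (∑ a ∈ u i, Finsupp.single (Fin.castAdd h a) 1 +
            ∑ c ∈ w j, Finsupp.single (Fin.natAdd h c) 1) g := by
      ext i j
      rw [Matrix.of_apply, Matrix.of_apply, hcoeff _ (degree_partitionExpo_le _ _)]
    rw [hmat]
    exact hg

/-- **EVERY PRINCIPAL MINOR OF THE PARTITION MATRIX IS HIT.** `h ≥ 4`; for every injective `u : Fin r → Finset (Fin h)`
the principal partition minor `[coeff_{x^{u i} y^{u j}} f]_{i,j}` is nonsingular at some `f ∈ SmallCircuits ℂ (h+h) 9`. -/
theorem partitionMinor_hit_principal (hh : 4 ≤ h) (u : Fin r → Finset (Fin h)) (hu : Function.Injective u) :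
    ∃ f ∈ SmallCircuits ℂ (h + h) 9,
      (Matrix.of fun i j : Fin r => MvPolynomial.coeff
        (∑ a ∈ u i, Finsupp.single (Fin.castAdd h a) 1 +
          ∑ c ∈ u j, Finsupp.single (Fin.natAdd h c) 1) f).det ≠ 0 :=
  partitionMinor_hit_samePattern hh u u hu hu rfl


/-! ## Relabeled columns: `Set.range w = π · Set.range u` -/

/-- **Relabeling the column coordinates.** If the layout `(u, j ↦ (w j).map σ)` is hit inside `SmallCircuits ℂ (h+h) b`
then so is `(u, w)` (rename the `y`-variables of the witness along `σ`; size and degree do not increase). -/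
theorem partitionMinor_hit_of_relabel_cols {b : ℕ} (σ : Equiv.Perm (Fin h)) (u w : Fin r → Finset (Fin h))
    (hhit : ∃ f ∈ SmallCircuits ℂ (h + h) b,
      (Matrix.of fun i j : Fin r => MvPolynomial.coeff
        (∑ a ∈ u i, Finsupp.single (Fin.castAdd h a) 1 +
          ∑ c ∈ (w j).map σ.toEmbedding, Finsupp.single (Fin.natAdd h c) 1) f).det ≠ 0) :
    ∃ f ∈ SmallCircuits ℂ (h + h) b,
      (Matrix.of fun i j : Fin r => MvPolynomial.coeff
        (∑ a ∈ u i, Finsupp.single (Fin.castAdd h a) 1 +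
          ∑ c ∈ w j, Finsupp.single (Fin.natAdd h c) 1) f).det ≠ 0 := by
  classical
  obtain ⟨f, ⟨hdeg, hsize⟩, hdet⟩ := hhit
  -- `τ` fixes the `x`-half and acts by `σ⁻¹` on the `y`-half
  let τ : Fin (h + h) ≃ Fin (h + h) :=
    finSumFinEquiv.symm.trans ((Equiv.sumCongr (Equiv.refl (Fin h)) σ.symm).trans finSumFinEquiv)
  have hτ1 : ∀ a : Fin h, τ (Fin.castAdd h a) = Fin.castAdd h a := by
    intro a
    simp only [τ, Equiv.trans_apply, finSumFinEquiv_symm_apply_castAdd, Equiv.sumCongr_apply, Sum.map_inl,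
      Equiv.refl_apply, finSumFinEquiv_apply_left]
  have hτ2 : ∀ c : Fin h, τ (Fin.natAdd h (σ c)) = Fin.natAdd h c := by
    intro c
    simp only [τ, Equiv.trans_apply, finSumFinEquiv_symm_apply_natAdd, Equiv.sumCongr_apply, Sum.map_inr,
      Equiv.symm_apply_apply, finSumFinEquiv_apply_right]
  have hmap : ∀ S T : Finset (Fin h), Finsupp.mapDomain τ
      (∑ a ∈ S, Finsupp.single (Fin.castAdd h a) 1 +
        ∑ c ∈ T.map σ.toEmbedding, Finsupp.single (Fin.natAdd h c) 1 : Fin (h + h) →₀ ℕ) =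
      ∑ a ∈ S, Finsupp.single (Fin.castAdd h a) 1 + ∑ c ∈ T, Finsupp.single (Fin.natAdd h c) 1 := by
    intro S T
    rw [Finsupp.mapDomain_add, Finsupp.mapDomain_finsetSum, Finsupp.mapDomain_finsetSum, Finset.sum_map]
    simp only [Finsupp.mapDomain_single, hτ1, Equiv.toEmbedding_apply, hτ2]
  refine ⟨rename τ f, ⟨(totalDegree_rename_le _ f).trans hdeg, (complexity_rename_le_holds' _ f).trans hsize⟩, ?_⟩
  have hmat : (Matrix.of fun i j : Fin r => MvPolynomial.coeff
      (∑ a ∈ u i, Finsupp.single (Fin.castAdd h a) 1 +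
        ∑ c ∈ w j, Finsupp.single (Fin.natAdd h c) 1) (rename τ f)) =
      Matrix.of fun i j : Fin r => MvPolynomial.coeff
        (∑ a ∈ u i, Finsupp.single (Fin.castAdd h a) 1 +
          ∑ c ∈ (w j).map σ.toEmbedding, Finsupp.single (Fin.natAdd h c) 1) f := by
    ext i j
    rw [Matrix.of_apply, Matrix.of_apply, ← hmap (u i) (w j), coeff_rename_mapDomain _ τ.injective]
  rw [hmat]
  exact hdet

/-- **EVERY «SAME PATTERN UP TO RELABELING» LAYOUT IS HIT.** `h ≥ 4`; if the column family is the row family with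
its coordinates relabeled by a permutation `π` (`Set.range w = {U.map π : U ∈ Set.range u}`, any two orders), the
layout is hit inside `SmallCircuits ℂ (h+h) 9`. -/
theorem partitionMinor_hit_samePattern_perm (hh : 4 ≤ h) (π : Equiv.Perm (Fin h)) (u w : Fin r → Finset (Fin h))
    (hu : Function.Injective u) (hw : Function.Injective w)
    (huw : Set.range w = Set.range fun i => (u i).map π.toEmbedding) :
    ∃ f ∈ SmallCircuits ℂ (h + h) 9,
      (Matrix.of fun i j : Fin r => MvPolynomial.coeff
        (∑ a ∈ u i, Finsupp.single (Fin.castAdd h a) 1 +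
          ∑ c ∈ w j, Finsupp.single (Fin.natAdd h c) 1) f).det ≠ 0 := by
  classical
  -- columns relabeled back by `π⁻¹` run through the same sets as the rows
  set w' : Fin r → Finset (Fin h) := fun j => (w j).map π.symm.toEmbedding with hw'
  have hw'inj : Function.Injective w' := fun i j hij => hw (Finset.map_injective π.symm.toEmbedding hij)
  have hback : ∀ U : Finset (Fin h), (U.map π.toEmbedding).map π.symm.toEmbedding = U := by
    intro U; rw [Finset.map_map]; convert Finset.map_refl (s := U) using 2; ext x; simp
  have huw' : Set.range u = Set.range w' := by
    ext S; constructor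
    · rintro ⟨i, rfl⟩
      have : (u i).map π.toEmbedding ∈ Set.range w := by rw [huw]; exact ⟨i, rfl⟩
      obtain ⟨j, hj⟩ := this
      exact ⟨j, by rw [hw']; simp only; rw [hj, hback]⟩
    · rintro ⟨j, rfl⟩
      obtain ⟨i, hi⟩ := (huw ▸ ⟨j, rfl⟩ : w j ∈ Set.range fun i => (u i).map π.toEmbedding)
      exact ⟨i, by rw [hw']; simp only; rw [← hi, hback]⟩
  -- `(u, w') = (u, j ↦ (w j).map π⁻¹)` is hit; relabel the columns back by `σ := π⁻¹`
  exact partitionMinor_hit_of_relabel_cols π.symm u w (partitionMinor_hit_samePattern hh u w' hu hw'inj huw')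

end

end Summit.ValiantsHypothesis.ValiantsHypothesis.Theorems.BarrierLever.FrobeniusDoor
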